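import Summits.Ventures.QEC.Census.CertCoverBatch
import Summits.Ventures.QEC.Census.BB.A1s_n192_k4_0fa3ae82.CoreDefs
import HarnessLib

set_option Elab.async false
set_option maxRecDepth 200000

/-!
# `[[192,4,18]]` one-level cover certificate — LEVEL-1→0 coset problems 41…50 (problem 1 excluded: `Prob1.lean`) as COMPACT data
(`ProbData`: U, f, σ, y₀, allow; qec-type-10 `CertCoverBatch.mkCoset` rebuilds each `CosetProb` in the kernel) + their verdict
`probsOK cov covR hx hx1 D1 lxd 16` (one `decide +kernel`). qec-search-9 g5 (lead block 170 (0)(c)); data from JSON `level10.problems`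
(sha256 08367568…). Data + decided check; KERNEL.
-/

namespace Summit.Ventures.QEC.Census.A1s_n192_k4_0fa3ae82

open Matrix Summit.Ventures.QEC.Census Literature.InformationTheory.QuantumCodes

/-- Problems 41…50 (10): `⟨U, f, σ, y₀, allow⟩`. -/
def probs00e : List ProbData := [
    ⟨18591705885772873993, 3, 2199032233984, 844424963686665, [0, 36893488147419103232]⟩,
    ⟨18717804487036193412, 0, 1099520278528, 18446744073709551616, [0]⟩,
    ⟨18736946990935576841, 1, 2199032233984, 844424963686665, [0, 144115188075855872, 36893488147419103232]⟩,
    ⟨18934540227693400708, 0, 1099520278528, 18446744073709551616, [0]⟩,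
    ⟨19368011709007815300, 0, 1099520278528, 18446744073709551616, [0]⟩,
    ⟨19458648848401703177, 0, 2199032233984, 844424963686665, [0]⟩,
    ⟨20234954671636611716, 1, 1099520278528, 18446744073709551616, [0, 16384, 2361183241434822606848]⟩,
    ⟨20252971275628136713, 0, 2199032233984, 72062017922603539, []⟩,
    ⟨20325591811029483785, 1, 2199032233984, 844424963686665, [0, 524288, 36893488147419103232]⟩,
    ⟨20770884884864926720, 0, 0, 0, [0]⟩]

set_option maxHeartbeats 400000000 in
/-- Every problem of this chunk passes (`mkCoset` elimination + `cosetOKD` + fast `σ` + depth + `BU`-evenness + label checks). -/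
theorem probs00e_ok : probsOK cov covR hx hx1 D1 lxd 16 probs00e = true := by
  decide +kernel

/-- Pointwise form. -/
theorem probs00e_all : ∀ x ∈ probs00e, probOK cov covR hx hx1 D1 lxd 16 x = true := by
  have h := probs00e_ok
  rwa [probsOK, List.all_eq_true] at h

end Summit.Ventures.QEC.Census.A1s_n192_k4_0fa3ae82
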